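import Summits.BirchSwinnertonDyer.Rank1Residual.AdditivePotMult.EigenLeadingTermThree
import Summits.BirchSwinnertonDyer.Rank1Residual.Additive.GordRankZeroChiBranch
import Summits.BirchSwinnertonDyer.Rank1Residual.Additive.SemistableTwistTamagawaFree
import Summits.BirchSwinnertonDyer.Rank1Residual.Additive.QuadraticTwistSurj
import Literature.NumberTheory.EllipticCurves.Wuthrich2014.ThreeAdicImage
import HarnessLib

/-!
# X3 / X4 with a `3`-semistable-ordinary twist by `−3`, analytic rank `0`: the UPPER HALF of
# `BSD(E,3)` from published theorems + kernel glue (the V9/V9b assemblies and the (G-ord) class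
# theorems at `p = 3` with their typed `χ₃`-branch input DISCHARGED)
# (cell `b2b-bsdres`, seat additive-p1, gen 9)

HONEST FRAMING (cell `b2b-bsdres`, run/shared/lean/b2b/bsd-rank1-residual/, verbatim in every
file): the goal of the cell is to DELETE the COMBINATION-SHAPED residual classes of the
Birch–Swinnerton-Dyer formula for ALL analytic-rank `≤ 1` elliptic curves over `ℚ` — "full BSD
formula for every rank `≤ 1` curve in class `C`" assembled STRICTLY from published theorems — so
that the rank-`≤ 1` remainder becomes exactly the CONSTRUCTION-SHAPED classes, which are TYPED
(missing-input `Prop`s), NOT attempted. This is not "finishing BSD". The additive sub-cell (seats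
additive-p1…p4) is a RESEARCH ROUTE on the construction-shaped classes X3/X4; no claim beyond the
stated classes; the labels of X3/X4 (and of the census cells (M), (G-ord)) are UNCHANGED by this
file; nothing is booked.

Theorems only (pure compositions; no definition, no named fact minted). Companion of
`RankZeroChiBranchThreeFacts.lean` (X3♯(M), X4(M)): here the SAME discharge
(`chiBranchLeadingTermOddAt_three`, `chiBranchLeadingTermOddBigImageAt_three`, file
`EigenLeadingTermThree.lean`, from the componentwise reading-facts p233088 / p233255) is fed into
additive-p4's twist-datum assemblies (`X3RankZeroTwistOdd.*_of_semistableTwist`,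
`X4RankZeroTwistOdd.*_of_semistableTwist`, file `Additive/SemistableTwistTamagawaFree.lean`, line
V9/V9b) and additive-p2's class theorems for the (G-ord) cells
(`ClassX3Gord.*_of_chiBranch'`, `ClassX4Gord.*_of_chiBranch`, file `Additive/GordRankZeroChiBranch.lean`):

* §1 **X3 ∧ `r_an(E) = 0` with ANY twist model `C • V^{(−3)} = W`, `V` good ordinary or
  multiplicative at `3`** (`ClassX3.missingUpperBoundAt_three_rankZero_of_twist`): the upper half
  `ord₃ #Ш(E) ≤ ord₃ #Ш_an(E)` from Delbourgo 1998 Prop. 4, GZK, modularity and Wuthrich 2014 Thm. 16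
  read on the `ω`-component (`hW16`) — the whole V9 domain at `p = 3` ((M) ∪ (G-ord, e = 2), 420 ‖ ·
  rank-`0` rows N < 2·10⁴ per additive-p4 gen 3) with NO typed input left; `BSD(E,3)` on the
  `3 ∤ #Ш_an` rows; what remains is EXACTLY the lower half;
* §2 **X3♯(G-ord) ∩ `I₀*` at `p = 3`** (`ClassX3Gord.missingUpperBoundAt_three_rankZero`, class form,
  twist model discharged by additive-p2's `ClassX3Gord.exists_goodOrd_pStar_twist_model`);
* §3 **X4 ∧ `r_an(E) = 0` ∧ surj(3) with any `3`-semistable-ordinary twist model**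
  (`ClassX4.missingUpperBoundAt_three_rankZero_of_twist_of_surj`): from Delbourgo, GZK, modularity,
  Wuthrich Lemma 20 (`hL20`: `ρ_{V,3^∞}` onto for the `3`-SEMISTABLE twist `V` from surj(3) of `E`)
  and Kato's divisibility read on the `ω`-component (`hKato`);
* §4 **X4♯(G-ord) ∩ `I₀*` ∧ surj(3) at `p = 3`** (`ClassX4Gord.missingUpperBoundAt_three_rankZero_of_surj`)
  — additive-p2's `ClassX4Gord.…_of_chiBranch` had a `p = 3 → ram(3)` premise for the `3`-adic image;
  here Lemma 20 on the GOOD twist replaces it (no `ram`, no Tamagawa, no Manin).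

Labels UNCHANGED; (M)/(G-ord) cells stay CONSTRUCTION-SHAPED (lower half printed nowhere; ranks
`≠ 0` untouched); nothing booked (referee).

References: Delbourgo 1998 [Delbourgo1998] Prop. 4; Wuthrich 2014 [Wuthrich2014] Thm. 16,
Lemma 20, Cor. 19; Kato 2004 [Kato2004Asterisque] Thm. 17.4; Mazur–Tate–Teitelbaum 1986
[MazurTateTeitelbaum1986Invent] §I.13–I.14.
-/

noncomputable section

open scoped Classical NumberField

open WeierstrassCurve NumberField Literature.NumberTheory.EllipticCurves
  Literature.NumberTheory.EllipticCurves.ModularForms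
  Literature.NumberTheory.EllipticCurves.Rank1Residual
  Literature.NumberTheory.EllipticCurves.Rank1Residual.Typed

namespace Summit.BirchSwinnertonDyer.Rank1Residual.AdditivePotMult

open Additive

variable {W : WeierstrassCurve ℚ} [W.IsElliptic] [W.IsGloballyMinimal]

/-! ### §0 The even-branch inputs are vacuous at `p = 3` (`3 % 4 ≠ 1`) -/

omit [W.IsElliptic] [W.IsGloballyMinimal] in
/-- At `p = 3` the even-branch typed input is vacuously true (its premise `3 % 4 = 1` fails).
[folklore] -/
theorem chiBranchLeadingTermAt_three (W : WeierstrassCurve ℚ) : ChiBranchLeadingTermAt W 3 := by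
  intro V _ _ κ γ N _ f h4
  omega

omit [W.IsElliptic] [W.IsGloballyMinimal] in
/-- At `p = 3` the even big-image typed input is vacuously true. [folklore] -/
theorem chiBranchLeadingTermBigImageAt_three (W : WeierstrassCurve ℚ) :
    ChiBranchLeadingTermBigImageAt W 3 := by
  intro V _ _ κ γ N _ f h4
  omega

/-! ### §1 X3, rank `0`, any `3`-semistable-ordinary twist model -/

/-- **X3 ∧ `r_an(E) = 0` at `p = 3` with a twist model `C • V^{(−3)} = W`, `V` good ordinary or
multiplicative at `3`: the upper half `ord₃ #Ш(E) ≤ ord₃ #Ш_an(E)`** from Delbourgo 1998 Prop. 4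
(`hDel`), GZK, modularity (`hmod`, `hmodD`: newform and minus period ratio of `V`) and Wuthrich 2014
Thm. 16 on the `ω`-component (`hW16`) — additive-p4's `X3RankZeroTwistOdd.missingUpperBoundAt_of_semistableTwist`
with its typed input DISCHARGED by `chiBranchLeadingTermOddAt_three`. Nothing booked.
[cite: Delbourgo1998, Prop. 4 (p. 144)] [cite: Wuthrich2014, Thm. 16 (p. 397)] -/
theorem ClassX3.missingUpperBoundAt_three_rankZero_of_twist
    (hDel : Delbourgo1998.prop4_rankZero_pow_dvd_constantCoeff)
    (hGZK : rank_eq_analyticRank_of_analyticRank_le_one) (hmod : hasEntireLFunction_rat)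
    (hmodD : nonempty_modularParametrizationData)
    (hW16 : Wuthrich2014.thm16_minusEigenCharIdeal_dvd_cyclotomicThree)
    (hX : ClassX3 W 3) (hr : W.analyticRank = 0)
    (V : WeierstrassCurve ℚ) [V.IsElliptic] [V.IsGloballyMinimal] (C : VariableChange ℚ)
    (hC : C • V.quadraticTwist (-3 : ℚ) = W) (hV : GoodOrd V 3 ∨ Mult V 3) :
    MissingUpperBoundAt W 3 := by
  haveI : NeZero (V.conductorNorm ℤ) := ⟨(V.conductorNorm_pos_holds).ne'⟩
  obtain ⟨Dm⟩ := hmodD V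
  obtain ⟨ϖ', -, hϖ'⟩ := exists_rat_mul_imaginaryPeriodRat_eq_minusPeriod Dm
  exact X3RankZeroTwistOdd.missingUpperBoundAt_of_semistableTwist W 3 hDel hGZK hmod
    (chiBranchLeadingTermOddAt_three hW16 W) (by norm_num) hr hX V C (by push_cast; exact hC) hV
    Dm.isNewformOf ϖ' hϖ'

/-- **X3 ∧ `r_an(E) = 0` ∧ (`3`-semistable-ordinary twist) ∧ `3 ∤ #Ш_an(E)`: `BSD(E,3)`.**
[cite: Delbourgo1998, Prop. 4 (p. 144)] [cite: Wuthrich2014, Thm. 16 (p. 397)] -/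
theorem ClassX3.bsdp_three_rankZero_of_twist_of_shaAn_unit
    (hDel : Delbourgo1998.prop4_rankZero_pow_dvd_constantCoeff)
    (hGZK : rank_eq_analyticRank_of_analyticRank_le_one) (hmod : hasEntireLFunction_rat)
    (hmodD : nonempty_modularParametrizationData)
    (hW16 : Wuthrich2014.thm16_minusEigenCharIdeal_dvd_cyclotomicThree)
    (hX : ClassX3 W 3) (hr : W.analyticRank = 0)
    (V : WeierstrassCurve ℚ) [V.IsElliptic] [V.IsGloballyMinimal] (C : VariableChange ℚ)
    (hC : C • V.quadraticTwist (-3 : ℚ) = W) (hV : GoodOrd V 3 ∨ Mult V 3)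
    {q : ℚ} (hq : shaAn W = (q : ℂ)) (hv : padicValRat 3 q = 0) : BSDp W 3 :=
  bsdp_of_missingPPartAt W 3 hGZK (by rw [hr]; exact zero_le_one)
    (missingPPartAt_of_upper_of_shaAn_unit W 3
      (ClassX3.missingUpperBoundAt_three_rankZero_of_twist hDel hGZK hmod hmodD hW16 hX hr V C hC hV)
      hq hv)

/-- **X3 ∧ `r_an(E) = 0` ∧ (`3`-semistable-ordinary twist): what remains of X3♯ is EXACTLY the
lower half** (`Typed.X3.MissingInputAt W 3 ⟺ MissingLowerBoundAt W 3`).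
[cite: Delbourgo1998, Prop. 4 (p. 144)] [cite: Wuthrich2014, Thm. 16 (p. 397)] -/
theorem ClassX3.missingInputAt_iff_lower_three_rankZero_of_twist
    (hDel : Delbourgo1998.prop4_rankZero_pow_dvd_constantCoeff)
    (hGZK : rank_eq_analyticRank_of_analyticRank_le_one) (hmod : hasEntireLFunction_rat)
    (hmodD : nonempty_modularParametrizationData)
    (hW16 : Wuthrich2014.thm16_minusEigenCharIdeal_dvd_cyclotomicThree)
    (hX : ClassX3 W 3) (hr : W.analyticRank = 0)
    (V : WeierstrassCurve ℚ) [V.IsElliptic] [V.IsGloballyMinimal] (C : VariableChange ℚ)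
    (hC : C • V.quadraticTwist (-3 : ℚ) = W) (hV : GoodOrd V 3 ∨ Mult V 3) :
    X3.MissingInputAt W 3 ↔ MissingLowerBoundAt W 3 :=
  ⟨fun h ↦ (lower_and_upper_of_missingPPartAt W 3 h).1, fun h ↦
    missingPPartAt_of_lower_of_upper W 3 h
      (ClassX3.missingUpperBoundAt_three_rankZero_of_twist hDel hGZK hmod hmodD hW16 hX hr V C hC hV)⟩

/-! ### §2 X3♯(G-ord) ∩ `I₀*` at `p = 3`, rank `0` -/

/-- **X3♯(G-ord) ∩ `I₀*` ∧ `r_an(E) = 0` at `p = 3`: the upper half** — additive-p2's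
`ClassX3Gord.missingUpperBoundAt_rankZero_of_chiBranch'` with BOTH typed inputs discharged (the even
one vacuously, the odd one by `chiBranchLeadingTermOddAt_three`). Inputs: `hDel`, `hGZK`, `hmod`,
`hmodD`, `hW16`. X3♯(G-ord) stays CONSTRUCTION-SHAPED; nothing booked.
[cite: Delbourgo1998, Prop. 4 (p. 144)] [cite: Wuthrich2014, Thm. 16 (p. 397)] -/
theorem ClassX3Gord.missingUpperBoundAt_three_rankZero
    (hDel : Delbourgo1998.prop4_rankZero_pow_dvd_constantCoeff)
    (hGZK : rank_eq_analyticRank_of_analyticRank_le_one) (hmod : hasEntireLFunction_rat)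
    (hmodD : nonempty_modularParametrizationData)
    (hW16 : Wuthrich2014.thm16_minusEigenCharIdeal_dvd_cyclotomicThree)
    (hX : ClassX3Gord W 3) (he : semistabilityIndex W 3 = 2) (hr : W.analyticRank = 0) :
    MissingUpperBoundAt W 3 :=
  ClassX3Gord.missingUpperBoundAt_rankZero_of_chiBranch' hDel hGZK hmod hmodD
    (chiBranchLeadingTermAt_three W) (chiBranchLeadingTermOddAt_three hW16 W) (by norm_num) hX he hr

/-- **X3♯(G-ord) ∩ `I₀*` ∧ `r_an(E) = 0` ∧ `3 ∤ #Ш_an(E)`: `BSD(E,3)`.**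
[cite: Delbourgo1998, Prop. 4 (p. 144)] [cite: Wuthrich2014, Thm. 16 (p. 397)] -/
theorem ClassX3Gord.bsdp_three_rankZero_of_shaAn_unit
    (hDel : Delbourgo1998.prop4_rankZero_pow_dvd_constantCoeff)
    (hGZK : rank_eq_analyticRank_of_analyticRank_le_one) (hmod : hasEntireLFunction_rat)
    (hmodD : nonempty_modularParametrizationData)
    (hW16 : Wuthrich2014.thm16_minusEigenCharIdeal_dvd_cyclotomicThree)
    (hX : ClassX3Gord W 3) (he : semistabilityIndex W 3 = 2) (hr : W.analyticRank = 0)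
    {q : ℚ} (hq : shaAn W = (q : ℂ)) (hv : padicValRat 3 q = 0) : BSDp W 3 :=
  ClassX3Gord.bsdp_rankZero_of_chiBranch_of_shaAn_unit' hDel hGZK hmod hmodD
    (chiBranchLeadingTermAt_three W) (chiBranchLeadingTermOddAt_three hW16 W) (by norm_num) hX he hr
    hq hv

/-- **X3♯(G-ord) ∩ `I₀*` ∧ `r_an(E) = 0` at `p = 3`: what remains is EXACTLY the lower half.**
[cite: Delbourgo1998, Prop. 4 (p. 144)] [cite: Wuthrich2014, Thm. 16 (p. 397)] -/
theorem ClassX3Gord.missingInputAt_iff_lower_three_rankZero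
    (hDel : Delbourgo1998.prop4_rankZero_pow_dvd_constantCoeff)
    (hGZK : rank_eq_analyticRank_of_analyticRank_le_one) (hmod : hasEntireLFunction_rat)
    (hmodD : nonempty_modularParametrizationData)
    (hW16 : Wuthrich2014.thm16_minusEigenCharIdeal_dvd_cyclotomicThree)
    (hX : ClassX3Gord W 3) (he : semistabilityIndex W 3 = 2) (hr : W.analyticRank = 0) :
    Gord.MissingInputAt W 3 ↔ MissingLowerBoundAt W 3 :=
  ClassX3Gord.missingInputAt_iff_lower_rankZero_of_chiBranch hDel hGZK hmod hmodD
    (chiBranchLeadingTermAt_three W) (chiBranchLeadingTermOddAt_three hW16 W) (by norm_num) hX he hr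

/-! ### §3 X4, rank `0`, any `3`-semistable-ordinary twist model, surj(3) -/

/-- **X4 ∧ `r_an(E) = 0` ∧ surj(3) at `p = 3` with a twist model `C • V^{(−3)} = W`, `V` good
ordinary or multiplicative at `3`: the upper half `ord₃ #Ш(E) ≤ ord₃ #Ш_an(E)`** from Delbourgo
1998 Prop. 4, GZK, modularity, Wuthrich 2014 Lemma 20 (`hL20`: `ρ̄_{V,3}` onto — transported from
`E` by `surj_iff_of_model_twist` — and `V` semistable at `3` give `ρ_{V,3^∞}` onto) and Kato's
divisibility on the `ω`-component (`hKato`) — additive-p4's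
`X4RankZeroTwistOdd.missingUpperBoundAt_of_semistableTwist` with its typed input DISCHARGED by
`chiBranchLeadingTermOddBigImageAt_three`. No `ram`, no Tamagawa, no Manin. Nothing booked.
[cite: Delbourgo1998, Prop. 4 (p. 144)] [cite: Wuthrich2014, Lemma 20 (p. 399), Cor. 19 (p. 398)]
[cite: Kato2004Asterisque, Thm. 17.4 (3) (p. 273)] -/
theorem ClassX4.missingUpperBoundAt_three_rankZero_of_twist_of_surj
    (hDel : Delbourgo1998.prop4_rankZero_pow_dvd_constantCoeff)
    (hGZK : rank_eq_analyticRank_of_analyticRank_le_one) (hmod : hasEntireLFunction_rat)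
    (hmodD : nonempty_modularParametrizationData)
    (hL20 : Wuthrich2014.lemma20_surjective_threeAdic_of_semistable)
    (hKato : Wuthrich2014.kato_minusEigenCharIdeal_dvd_cyclotomicThree_of_surjective)
    (hX : ClassX4 W 3) (hr : W.analyticRank = 0) (hsurj : Surj W 3)
    (V : WeierstrassCurve ℚ) [V.IsElliptic] [V.IsGloballyMinimal] (C : VariableChange ℚ)
    (hC : C • V.quadraticTwist (-3 : ℚ) = W) (hV : GoodOrd V 3 ∨ Mult V 3) :
    MissingUpperBoundAt W 3 := by
  haveI : NeZero (V.conductorNorm ℤ) := ⟨(V.conductorNorm_pos_holds).ne'⟩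
  obtain ⟨Dm⟩ := hmodD V
  obtain ⟨ϖ', -, hϖ'⟩ := exists_rat_mul_imaginaryPeriodRat_eq_minusPeriod Dm
  have hsV : Surj V 3 := (surj_iff_of_model_twist V 3 (by norm_num : (-3 : ℚ) ≠ 0) ⟨C, hC⟩).mp hsurj
  have hsurjV : ∀ n : ℕ, V.HasSurjectiveModNGaloisRep (3 ^ n : ℕ) :=
    hL20 V (hV.elim (fun h ↦ Or.inl h.1) Or.inr) hsV
  exact X4RankZeroTwistOdd.missingUpperBoundAt_of_semistableTwist W 3 hDel hGZK hmod
    (chiBranchLeadingTermOddBigImageAt_three hKato W) (by norm_num) hr hX V C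
    (by push_cast; exact hC) hV hsurjV Dm.isNewformOf ϖ' hϖ'

/-- **X4 ∧ `r_an(E) = 0` ∧ surj(3) ∧ (`3`-semistable-ordinary twist) ∧ `3 ∤ #Ш_an(E)`: `BSD(E,3)`.**
[cite: Delbourgo1998, Prop. 4 (p. 144)] [cite: Wuthrich2014, Lemma 20 (p. 399), Cor. 19 (p. 398)]
[cite: Kato2004Asterisque, Thm. 17.4 (3) (p. 273)] -/
theorem ClassX4.bsdp_three_rankZero_of_twist_of_surj_of_shaAn_unit
    (hDel : Delbourgo1998.prop4_rankZero_pow_dvd_constantCoeff)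
    (hGZK : rank_eq_analyticRank_of_analyticRank_le_one) (hmod : hasEntireLFunction_rat)
    (hmodD : nonempty_modularParametrizationData)
    (hL20 : Wuthrich2014.lemma20_surjective_threeAdic_of_semistable)
    (hKato : Wuthrich2014.kato_minusEigenCharIdeal_dvd_cyclotomicThree_of_surjective)
    (hX : ClassX4 W 3) (hr : W.analyticRank = 0) (hsurj : Surj W 3)
    (V : WeierstrassCurve ℚ) [V.IsElliptic] [V.IsGloballyMinimal] (C : VariableChange ℚ)
    (hC : C • V.quadraticTwist (-3 : ℚ) = W) (hV : GoodOrd V 3 ∨ Mult V 3)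
    {q : ℚ} (hq : shaAn W = (q : ℂ)) (hv : padicValRat 3 q = 0) : BSDp W 3 :=
  bsdp_of_missingPPartAt W 3 hGZK (by rw [hr]; exact zero_le_one)
    (missingPPartAt_of_upper_of_shaAn_unit W 3
      (ClassX4.missingUpperBoundAt_three_rankZero_of_twist_of_surj hDel hGZK hmod hmodD hL20 hKato hX
        hr hsurj V C hC hV) hq hv)

/-- **X4 ∧ `r_an(E) = 0` ∧ surj(3) ∧ (`3`-semistable-ordinary twist): what remains of X4♯ is EXACTLY
the lower half.** [cite: Delbourgo1998, Prop. 4 (p. 144)]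
[cite: Wuthrich2014, Lemma 20 (p. 399), Cor. 19 (p. 398)] -/
theorem ClassX4.missingInputAt_iff_lower_three_rankZero_of_twist_of_surj
    (hDel : Delbourgo1998.prop4_rankZero_pow_dvd_constantCoeff)
    (hGZK : rank_eq_analyticRank_of_analyticRank_le_one) (hmod : hasEntireLFunction_rat)
    (hmodD : nonempty_modularParametrizationData)
    (hL20 : Wuthrich2014.lemma20_surjective_threeAdic_of_semistable)
    (hKato : Wuthrich2014.kato_minusEigenCharIdeal_dvd_cyclotomicThree_of_surjective)
    (hX : ClassX4 W 3) (hr : W.analyticRank = 0) (hsurj : Surj W 3)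
    (V : WeierstrassCurve ℚ) [V.IsElliptic] [V.IsGloballyMinimal] (C : VariableChange ℚ)
    (hC : C • V.quadraticTwist (-3 : ℚ) = W) (hV : GoodOrd V 3 ∨ Mult V 3) :
    X4.MissingInputAt W 3 ↔ MissingLowerBoundAt W 3 :=
  ⟨fun h ↦ (lower_and_upper_of_missingPPartAt W 3 h).1, fun h ↦
    missingPPartAt_of_lower_of_upper W 3 h
      (ClassX4.missingUpperBoundAt_three_rankZero_of_twist_of_surj hDel hGZK hmod hmodD hL20 hKato hX
        hr hsurj V C hC hV)⟩

/-! ### §4 X4♯(G-ord) ∩ `I₀*` ∧ surj(3) at `p = 3`, rank `0` — no `ram` premise -/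

/-- **X4♯(G-ord) ∩ `I₀*` ∧ `r_an(E) = 0` ∧ surj(3) at `p = 3`: the upper half** — the twist model of
additive-p2's `ClassX4Gord.exists_goodOrd_pStar_twist_model` (`V` GOOD ordinary at `3`) fed into
§3; Wuthrich Lemma 20 on the good twist replaces the `p = 3 → ram(3)` premise of
`ClassX4Gord.missingUpperBoundAt_rankZero_of_chiBranch`. X4♯(G-ord) stays CONSTRUCTION-SHAPED;
nothing booked. [cite: Delbourgo1998, Prop. 4 (p. 144)] [cite: Wuthrich2014, Lemma 20 (p. 399)]
[cite: Kato2004Asterisque, Thm. 17.4 (3) (p. 273)] -/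
theorem ClassX4Gord.missingUpperBoundAt_three_rankZero_of_surj
    (hDel : Delbourgo1998.prop4_rankZero_pow_dvd_constantCoeff)
    (hGZK : rank_eq_analyticRank_of_analyticRank_le_one) (hmod : hasEntireLFunction_rat)
    (hmodD : nonempty_modularParametrizationData)
    (hL20 : Wuthrich2014.lemma20_surjective_threeAdic_of_semistable)
    (hKato : Wuthrich2014.kato_minusEigenCharIdeal_dvd_cyclotomicThree_of_surjective)
    (hX : ClassX4Gord W 3) (he : semistabilityIndex W 3 = 2) (hr : W.analyticRank = 0)
    (hsurj : Surj W 3) : MissingUpperBoundAt W 3 := by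
  obtain ⟨V, iV, iVm, C, hV, hC⟩ := hX.exists_goodOrd_pStar_twist_model W 3 he
  have hC' : C • V.quadraticTwist (-3 : ℚ) = W := by norm_num at hC; exact hC
  exact ClassX4.missingUpperBoundAt_three_rankZero_of_twist_of_surj hDel hGZK hmod hmodD hL20 hKato
    hX.classX4 hr hsurj V C hC' (Or.inl hV)

/-- **X4♯(G-ord) ∩ `I₀*` ∧ `r_an(E) = 0` ∧ surj(3) ∧ `3 ∤ #Ш_an(E)`: `BSD(E,3)`** (no `ram`, no
Tamagawa, no Manin). [cite: Delbourgo1998, Prop. 4 (p. 144)] [cite: Wuthrich2014, Lemma 20 (p. 399)]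
[cite: Kato2004Asterisque, Thm. 17.4 (3) (p. 273)] -/
theorem ClassX4Gord.bsdp_three_rankZero_of_surj_of_shaAn_unit
    (hDel : Delbourgo1998.prop4_rankZero_pow_dvd_constantCoeff)
    (hGZK : rank_eq_analyticRank_of_analyticRank_le_one) (hmod : hasEntireLFunction_rat)
    (hmodD : nonempty_modularParametrizationData)
    (hL20 : Wuthrich2014.lemma20_surjective_threeAdic_of_semistable)
    (hKato : Wuthrich2014.kato_minusEigenCharIdeal_dvd_cyclotomicThree_of_surjective)
    (hX : ClassX4Gord W 3) (he : semistabilityIndex W 3 = 2) (hr : W.analyticRank = 0)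
    (hsurj : Surj W 3) {q : ℚ} (hq : shaAn W = (q : ℂ)) (hv : padicValRat 3 q = 0) : BSDp W 3 :=
  bsdp_of_missingPPartAt W 3 hGZK (by rw [hr]; exact zero_le_one)
    (missingPPartAt_of_upper_of_shaAn_unit W 3
      (ClassX4Gord.missingUpperBoundAt_three_rankZero_of_surj hDel hGZK hmod hmodD hL20 hKato hX he
        hr hsurj) hq hv)

/-- **X4♯(G-ord) ∩ `I₀*` ∧ `r_an(E) = 0` ∧ surj(3) at `p = 3`: what remains is EXACTLY the lower
half.** [cite: Delbourgo1998, Prop. 4 (p. 144)] [cite: Wuthrich2014, Lemma 20 (p. 399)] -/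
theorem ClassX4Gord.missingInputAt_iff_lower_three_rankZero_of_surj
    (hDel : Delbourgo1998.prop4_rankZero_pow_dvd_constantCoeff)
    (hGZK : rank_eq_analyticRank_of_analyticRank_le_one) (hmod : hasEntireLFunction_rat)
    (hmodD : nonempty_modularParametrizationData)
    (hL20 : Wuthrich2014.lemma20_surjective_threeAdic_of_semistable)
    (hKato : Wuthrich2014.kato_minusEigenCharIdeal_dvd_cyclotomicThree_of_surjective)
    (hX : ClassX4Gord W 3) (he : semistabilityIndex W 3 = 2) (hr : W.analyticRank = 0)
    (hsurj : Surj W 3) : X4.MissingInputAt W 3 ↔ MissingLowerBoundAt W 3 :=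
  ⟨fun h ↦ (lower_and_upper_of_missingPPartAt W 3 h).1, fun h ↦
    missingPPartAt_of_lower_of_upper W 3 h
      (ClassX4Gord.missingUpperBoundAt_three_rankZero_of_surj hDel hGZK hmod hmodD hL20 hKato hX he
        hr hsurj)⟩

end Summit.BirchSwinnertonDyer.Rank1Residual.AdditivePotMult

end
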